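import Summits.BirchSwinnertonDyer.BirchSwinnertonDyer.Theorems.SmallImageMuTransferMuTransferX9SmallImageGenerator
import Summits.BirchSwinnertonDyer.BirchSwinnertonDyer.Theorems.SmallImageMuTransferMuTransferX9StepOneResidue
import Literature.NumberTheory.GaloisRepresentations.ContinuousH1TrivialRestriction
import HarnessLib

/-!
# Step 1 of the `μ`-transfer core (`stub_coreX9`, crux 19276): `im h = 𝒯_{J+1}` end-to-end

HOME/koly/MU-TRANSFER-PROOF.md §5 STEP 1, first half, assembled on the GENUINE objects from the
cell's kernel lemmas: for `κ' ∈ 𝐇¹_Ω(E[p])` (`ZpExtension.twistTower`) with `κ̄' ≠ 0`, a cocycle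
`φ` representing `κ'_{J+1}`, and a normal subextension `L₀/ℚ` of `ℚ̄/ℚ` whose group
`S = Gal(ℚ̄/L₀)` acts trivially on `𝒯_{J+1}(E)` and for which `res : H¹(ℚ, E[p]) → H¹(L₀, E[p])` is
injective (Sah; tree `res_one_injective_of_forall_fixed_eq_zero`), the value group
`h(S) = φ(S) ⊂ 𝒯_{J+1}(E)` is ALL of `𝒯_{J+1}(E)` under `Irr ∧ ¬Surj`
(`valueSubgroup_eq_top`): it is `Γ_ℚ`-stable (`contOneCocycles.smul_mem_valueSubgroup`), hence
`T^j 𝒯` (Lemma 3(i), `modPTwist_stable_addSubgroup_eq_tPow_of_irr_of_not_surj`), and contains a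
value with non-zero constant coefficient (`exists_mem_absGaloisFixingSubgroup_apply_zero_ne_zero`),
so `j = 0` (cf. `modPTwist_stable_addSubgroup_eq_top_of_apply_zero_ne_zero`). This is hypothesis `h1` of
`LevelE.theoremA_contradiction_schema` ("`M` projects onto `𝒯_e`").

PARTITION (D-0054): X9 (A4) — helper toward `stub_coreX9`; closes none.
-/

set_option linter.dupNamespace false

noncomputable section

open Literature.NumberTheory.EllipticCurves Literature.NumberTheory.GaloisRepresentations Field
  Function

namespace Summit.BirchSwinnertonDyer.BirchSwinnertonDyer.Rank1Residual.LevelE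

variable (W : WeierstrassCurve ℚ) [W.IsElliptic] (p : ℕ) [Fact p.Prime] (κ : ZpExtension ℚ p)

/-- **STEP 1, `im h = 𝒯_{J+1}(E)`** (MU-TRANSFER-PROOF §5 STEP 1 with (F4), (F8), Lemma 3(i)), on
genuine objects and under `Irr ∧ ¬Surj`: the value group on `Gal(ℚ̄/L₀)` of a cocycle representing
the level-`J+1` component of an `Ω`-adic class with non-zero constant coefficient is everything.
[cite: Serre1972, §2.4 Prop. 15] [cite: MazurRubin2004, §5.3] [cite: NeukirchSchmidtWingberg2008, (1.6.7)] -/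
theorem valueSubgroup_eq_top (hirr : W.HasIrreducibleModPGaloisRep p)
    (hns : ¬ W.HasSurjectiveModNGaloisRep p) {γ : absoluteGaloisGroup ℚ} (hγ : κ.IsTopGenerator γ)
    (J : ℕ) (φ : contOneCocycles (W.modPTwist p κ (J + 1)).toTopRep)
    (S : Subgroup (absoluteGaloisGroup ℚ)) [S.Normal]
    (hS : ∀ τ ∈ S, ∀ x : (W.modPTwist p κ (J + 1)).toTopRep,
      (W.modPTwist p κ (J + 1)).toTopRep.ρ τ x = x)
    (h0 : ∃ τ ∈ S, φ.1 τ ⟨0, Nat.succ_pos J⟩ ≠ 0) :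
    contOneCocycles.valueSubgroup φ S hS = ⊤ := by
  -- Lemma 3(i): the `Γ_ℚ`-stable value group is `T^j 𝒯_{J+1}`
  obtain ⟨j, -, hiff⟩ := modPTwist_stable_addSubgroup_eq_tPow_of_irr_of_not_surj W p κ (J + 1) hirr
    hns (Nat.succ_pos J) hγ (contOneCocycles.valueSubgroup φ S hS)
    (fun σ x hx => contOneCocycles.smul_mem_valueSubgroup φ _ hS σ hx)
  -- (F4)/(F8): a value with non-zero constant coefficient, so `j = 0`
  obtain ⟨τ, hτ, hne⟩ := h0
  have hj : j = 0 := by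
    by_contra hj
    exact hne ((hiff (φ.1 τ)).mp ⟨τ, hτ, rfl⟩ ⟨0, Nat.succ_pos J⟩ (Nat.pos_of_ne_zero hj))
  refine (AddSubgroup.eq_top_iff' _).mpr fun x => (hiff x).mpr fun i hi => ?_
  rw [hj] at hi
  exact absurd hi (Nat.not_lt_zero _)

/-- The same with the (F8) input spelled out on the `Ω`-adic tower: `κ' ∈ 𝐇¹_Ω(E[p])` with
`κ̄' ≠ 0`, `φ` representing `κ'_{J+1}`, and `S ⊴ Γ_ℚ` acting trivially on `𝒯_{J+1}(E)` such that
every cocycle of `E[p]` with non-zero class is non-zero on `S` (e.g. `S = Gal(ℚ̄/L₀)` with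
`res : H¹(ℚ, E[p]) → H¹(L₀, E[p])` injective by Sah, tree
`galoisCohomology.exists_mem_absGaloisFixingSubgroup_apply_ne_zero`): then `h(S) = 𝒯_{J+1}(E)`.
[cite: Serre1972, §2.4 Prop. 15] [cite: MazurRubin2004, §5.3] -/
theorem valueSubgroup_eq_top_of_towerConst_ne_zero (hirr : W.HasIrreducibleModPGaloisRep p)
    (hns : ¬ W.HasSurjectiveModNGaloisRep p) {γ : absoluteGaloisGroup ℚ} (hγ : κ.IsTopGenerator γ)
    (y : κ.twistTower (W.torsionGaloisModule (p : ℤ))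
      (fun P : WeierstrassCurve.geomTorsion W (p : ℤ) => AddSubgroup.torsionBy.nsmul P))
    (hy : κ.towerConst (W.torsionGaloisModule (p : ℤ)) (fun P => AddSubgroup.torsionBy.nsmul P) y ≠ 0)
    (J : ℕ) (φ : contOneCocycles (W.modPTwist p κ (J + 1)).toTopRep)
    (hφ : oneCocycleClass (W.modPTwist p κ (J + 1)).toTopRep φ = y.1 (J + 1))
    (S : Subgroup (absoluteGaloisGroup ℚ)) [S.Normal]
    (hS : ∀ τ ∈ S, ∀ x : (W.modPTwist p κ (J + 1)).toTopRep,
      (W.modPTwist p κ (J + 1)).toTopRep.ρ τ x = x)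
    (hSah : ∀ ψ : contOneCocycles (W.torsionGaloisModule (p : ℤ)).toTopRep,
      oneCocycleClass (W.torsionGaloisModule (p : ℤ)).toTopRep ψ ≠ 0 → ∃ τ ∈ S, ψ.1 τ ≠ 0) :
    contOneCocycles.valueSubgroup φ S hS = ⊤ := by
  refine valueSubgroup_eq_top W p κ hirr hns hγ J φ S hS ?_
  -- `κ̄' = H¹(const)(κ'_{J+1}) = [const ∘ φ] ≠ 0`
  have hc : galoisCohomology.map (κ.twistModPConstCoeff (W.torsionGaloisModule (p : ℤ))
      (fun P => AddSubgroup.torsionBy.nsmul P) (J + 1) (Nat.succ_pos J)) 1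
      (oneCocycleClass (W.modPTwist p κ (J + 1)).toTopRep φ) ≠ 0 := by
    rw [hφ, map_constCoeff_level_eq_towerConst]
    exact hy
  change galoisCohomology.map _ 1 (oneCocycleClass (κ.twistModP (W.torsionGaloisModule (p : ℤ))
      (fun P => AddSubgroup.torsionBy.nsmul P) (J + 1)).toTopRep φ) ≠ 0 at hc
  rw [ZpExtension.map_oneCocycleClass_twist] at hc
  obtain ⟨τ, hτ, hne⟩ := hSah _ hc
  exact ⟨τ, hτ, hne⟩

end Summit.BirchSwinnertonDyer.BirchSwinnertonDyer.Rank1Residual.LevelE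

end
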